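import Summits.KontsevichZagierPeriods.KontsevichZagierPeriods.Theorems.BetaCancellation.Negative.Torsion

/-!
# `BetaCancellation` (stmt-KontsevichZagierPeriods-13633) — the primitive criterion

cdisprove (refuter, gen 2) file for crux #4 `BetaCancellation` of route TerasomaMultiplication
(namespace `…BetaCancellationNegative`, companions `Negative/KernelForm.lean`, `Negative/LoadBearing.lean`).
Sorry-free, axioms ⊆ {propext, Classical.choice, Quot.sound}.

**THE PRIMITIVE CRITERION** `kernelCancellation_iff_of_primitive`: for a kernel `k` on `[0,1]` with a
`ℚ`-semialgebraic primitive `K ∈ C([0,1])`, `K' = k` on `(0,1)`: `KernelCancellation k ↔ K 1 ≠ K 0`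
(`= ∫₀¹ k`, `integral_eq_of_primitive`). (→) ONE Newton–Leibniz move over an ARBITRARY base,
`[σ × [0,1], f ⊗ k] − [σ, (K 1 − K 0)·f] ∈ newtonLeibnizRel` (`prod_iccRep_sub_constMul_mem_newtonLeibnizRel`),
then cancel the algebraic scalar (`Negative/Torsion.lean`); (←) every pinned representation is a
relation, and `[π] ≁ −[π]`. So for the kernels the calculus can integrate in closed form,
cancellation is DECIDED inside the calculus by the value — the complement of the open core of the
crux (Beta kernels with both exponents non-integer). Applications: `Negative/CriterionApplications.lean`.
-/

noncomputable section

set_option linter.dupNamespace false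

namespace Summit.KontsevichZagierPeriods.KontsevichZagierPeriods.BetaCancellationNegative

open MeasureTheory Set
open Literature.NumberTheory.Transcendental
open Literature.NumberTheory.Transcendental.KZ
open Literature.ModelTheory.ExponentialFields (IsSemialgebraic isSemialgebraic_univ)
open MvPolynomial (aeval X C)
open Summit.KontsevichZagierPeriods.KontsevichZagierPeriods.Theses.TerasomaMultiplication
  (BetaCancellation)
open Literature.NumberTheory.Transcendental.KZreg (unitIoo isSemialgebraic_unitIoo volume_unitIoo)

/-! ## §12 THE PRIMITIVE CRITERION: kernels the calculus can integrate in closed form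

For a kernel `k` on `[0,1]` admitting a `ℚ`-semialgebraic primitive `K ∈ C([0,1])`, `K' = k` on
`(0,1)`, cancellation is DECIDED inside the calculus by the value `K 1 − K 0 = ∫₀¹ k`:
`KernelCancellation k ↔ K 1 ≠ K 0`. The `→` half is one Newton–Leibniz move over an arbitrary base
(`q ∼ [σ, (K 1 − K 0) f]`) and the cancellation of the algebraic scalar `K 1 − K 0`; the `←` half
is `q ∼ [σ, 0] ∈ relations` for every base, and `[π] ≁ −[π]`. -/

/-- The closed unit interval `[0,1] ⊆ ℝ¹`. [folklore] -/
def unitIcc : Set (Fin 1 → ℝ) := {x | x 0 ∈ Icc (0:ℝ) 1}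

/-- Membership in `unitIcc`. [folklore] -/
@[simp] theorem mem_unitIcc (x : Fin 1 → ℝ) : x ∈ unitIcc ↔ x 0 ∈ Icc (0:ℝ) 1 := Iff.rfl

/-- `[0,1] ⊆ ℝ¹` is `ℚ`-semialgebraic. [folklore] -/
theorem isSemialgebraic_unitIcc : IsSemialgebraic ℚ unitIcc := by
  have h1 := Literature.ModelTheory.ExponentialFields.isSemialgebraic_setOf_eval_le (k := ℚ) (R := ℝ)
    (0 : MvPolynomial (Fin 1) ℚ) (X 0)
  have h2 := Literature.ModelTheory.ExponentialFields.isSemialgebraic_setOf_eval_le (k := ℚ) (R := ℝ)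
    (X 0 : MvPolynomial (Fin 1) ℚ) 1
  have h := h1.inter h2
  simp only [map_zero, map_one, MvPolynomial.aeval_X] at h
  have hset : unitIcc = {x : Fin 1 → ℝ | 0 ≤ x 0} ∩ {x | x 0 ≤ 1} := by
    ext x
    simp [unitIcc]
  rw [hset]
  exact h

/-- `(0,1) ⊆ [0,1]`. [folklore] -/
theorem unitIoo_subset_unitIcc : unitIoo ⊆ unitIcc := fun _ hx => ⟨hx.1.le, hx.2.le⟩

/-- `[0,1] ∖ (0,1)` is null. [folklore] -/
theorem volume_unitIcc_diff_unitIoo : volume (unitIcc \ unitIoo) = 0 := by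
  refine measure_mono_null (fun x hx => ?_)
    (measure_union_null (volume_setOf_apply_eq_zero (0 : Fin 1) 0)
      (volume_setOf_apply_eq_zero (0 : Fin 1) 1))
  simp only [mem_sdiff, mem_unitIcc, mem_Icc, mem_unitIoo, mem_Ioo, not_and, not_lt] at hx
  simp only [mem_union, mem_setOf_eq]
  obtain ⟨⟨h1, h2⟩, h3⟩ := hx
  rcases h1.lt_or_eq with h1 | h1
  · exact Or.inr (le_antisymm h2 (h3 h1))
  · exact Or.inl h1.symm

/-- `[0,1] ⊆ ℝ¹` is the closed box. [folklore] -/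
theorem unitIcc_eq_pi : unitIcc = Set.pi univ fun _ : Fin 1 => Icc (0:ℝ) 1 := by
  ext x
  simp only [unitIcc, mem_setOf_eq, mem_univ_pi, Fin.forall_fin_one]

/-- `[[0,1], g]`: the representation on the closed unit interval with integrand `g (x 0)`.
[folklore] -/
def iccRep (g : ℝ → ℝ) (hg : IsSemialgebraicFunOn ℚ unitIcc (fun x => g (x 0)))
    (hgi : IntegrableOn g (Icc (0:ℝ) 1)) : IntegralRep 1 where
  domain := unitIcc
  integrand := fun x => g (x 0)
  isSemialgebraic_domain := isSemialgebraic_unitIcc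
  isSemialgebraicFunOn_integrand := hg
  integrableOn := integrableOn_comp_apply_zero_iff.2 hgi

/-- The domain of `iccRep`. [folklore] -/
@[simp] theorem iccRep_domain (g : ℝ → ℝ) (hg : IsSemialgebraicFunOn ℚ unitIcc (fun x => g (x 0)))
    (hgi : IntegrableOn g (Icc (0:ℝ) 1)) : (iccRep g hg hgi).domain = unitIcc := rfl

/-- The integrand of `iccRep`. [folklore] -/
@[simp] theorem iccRep_integrand (g : ℝ → ℝ) (hg : IsSemialgebraicFunOn ℚ unitIcc (fun x => g (x 0)))
    (hgi : IntegrableOn g (Icc (0:ℝ) 1)) : (iccRep g hg hgi).integrand = fun x => g (x 0) := rfl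

/-- The last coordinate of `ℝ^{n+1}` as `Fin.natAdd n 0`. [folklore] -/
theorem natAdd_zero_eq_last (n : ℕ) : (Fin.natAdd n (0 : Fin 1) : Fin (n + 1)) = Fin.last n :=
  Fin.ext (by simp)

/-- `Fin.init` through `Fin.castAdd 1`. [folklore] -/
theorem init_eq_comp_castAdd {n : ℕ} (z : Fin (n + 1) → ℝ) :
    (Fin.init z : Fin n → ℝ) = fun i => z (Fin.castAdd 1 i) := rfl

/-- The integrand of `r × [[0,1], g]` on a fibre `Fin.snoc x t`. [folklore] -/
theorem prod_iccRep_integrand_snoc {n : ℕ} (r : IntegralRep n) (g : ℝ → ℝ)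
    (hg : IsSemialgebraicFunOn ℚ unitIcc (fun x => g (x 0))) (hgi : IntegrableOn g (Icc (0:ℝ) 1))
    (x : Fin n → ℝ) (t : ℝ) :
    (r.prod (iccRep g hg hgi)).integrand (Fin.snoc x t) = r.integrand x * g t := by
  rw [IntegralRep.prod_integrand_eq]
  simp only [IntegralRep.prodFun, iccRep_integrand]
  congr 1
  · congr 1
    funext i
    exact Fin.snoc_castSucc (α := fun _ => ℝ) t x i
  · rw [natAdd_zero_eq_last, Fin.snoc_last]

/-- **ONE Newton–Leibniz move over an arbitrary base**: `[σ × [0,1], f ⊗ k] − [σ, (K 1 − K 0)·f]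
∈ newtonLeibnizRel`, with primitive `F = f ⊗ K`. [cite: KontsevichZagier2001, §1.2 rule (3)] -/
theorem prod_iccRep_sub_constMul_mem_newtonLeibnizRel {n : ℕ} (r : IntegralRep n) {k K : ℝ → ℝ}
    (hk : IsSemialgebraicFunOn ℚ unitIcc (fun x => k (x 0))) (hki : IntegrableOn k (Icc (0:ℝ) 1))
    (hK : IsSemialgebraicFunOn ℚ unitIcc (fun x => K (x 0))) (hKc : ContinuousOn K (Icc (0:ℝ) 1))
    (hKd : ∀ t ∈ Ioo (0:ℝ) 1, HasDerivAt K (k t) t) (halg : IsAlgebraic ℚ (K 1 - K 0)) :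
    of (r.prod (iccRep k hk hki)) - of (r.constMul (K 1 - K 0) halg) ∈ newtonLeibnizRel := by
  have hKi : IntegrableOn K (Icc (0:ℝ) 1) := hKc.integrableOn_compact isCompact_Icc
  refine ⟨n, r.prod (iccRep k hk hki), r.constMul (K 1 - K 0) halg, fun _ => ((0:ℕ):ℝ),
    fun _ => ((0:ℕ):ℝ) + 1, (r.prod (iccRep K hK hKi)).integrand,
    (r.prod (iccRep K hK hKi)).isSemialgebraicFunOn_integrand,
    isSemialgebraicFunOn_natCast r.isSemialgebraic_domain 0, ?_, fun _ _ => by simp, ?_, ?_, ?_, ?_,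
    rfl⟩
  · exact (isSemialgebraicFunOn_aeval r.isSemialgebraic_domain
      (((0:ℕ) : MvPolynomial (Fin n) ℚ) + 1)).congr fun x _ => by simp
  · ext z
    simp only [IntegralRep.prod_domain, IntegralRep.mem_prodDomain, iccRep_domain, mem_unitIcc,
      mem_Icc, IntegralRep.domain_constMul, mem_setOf_eq, Nat.cast_zero, zero_add,
      init_eq_comp_castAdd, natAdd_zero_eq_last]
  · intro x _
    simp only [prod_iccRep_integrand_snoc, Nat.cast_zero, zero_add]
    exact continuousOn_const.mul hKc
  · intro x _ t ht
    simp only [Nat.cast_zero, zero_add] at ht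
    have hF : (fun s : ℝ => (r.prod (iccRep K hK hKi)).integrand (Fin.snoc x s)) =
        fun s => r.integrand x * K s := by
      funext s
      exact prod_iccRep_integrand_snoc r K hK hKi x s
    rw [hF, prod_iccRep_integrand_snoc]
    exact (hKd t ht).const_mul (r.integrand x)
  · intro x _
    simp only [prod_iccRep_integrand_snoc, IntegralRep.integrand_constMul, Nat.cast_zero, zero_add]
    ring

/-- **A representation pinned with kernel `k` over `r` is equivalent to `[σ, (K 1 − K 0)·f]`**
when `k` has the `ℚ`-semialgebraic primitive `K` on `[0,1]` (congruence, commutativity of `×`,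
a null boundary, and the Newton–Leibniz move). [folklore] -/
theorem equivalent_constMul_of_isPinned_of_primitive {n : ℕ} {k K : ℝ → ℝ}
    (hk : IsSemialgebraicFunOn ℚ unitIcc (fun x => k (x 0))) (hki : IntegrableOn k (Icc (0:ℝ) 1))
    (hK : IsSemialgebraicFunOn ℚ unitIcc (fun x => K (x 0))) (hKc : ContinuousOn K (Icc (0:ℝ) 1))
    (hKd : ∀ t ∈ Ioo (0:ℝ) 1, HasDerivAt K (k t) t) (halg : IsAlgebraic ℚ (K 1 - K 0))
    {r : IntegralRep n} {q : IntegralRep (1 + n)} (hq : IsPinned k r q) :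
    Equivalent q (r.constMul (K 1 - K 0) halg) := by
  set κ := iccRep k hk hki with hκ
  set κ₀ := κ.restrict unitIoo isSemialgebraic_unitIoo unitIoo_subset_unitIcc with hκ₀
  have hp : IsPinned k r (κ₀.prod r) := isPinned_prod κ₀ rfl (fun _ _ => rfl) r
  have h1 : Equivalent q (κ₀.prod r) := by
    refine of_sub_of_mem_relations_of_eqOn (hp.1.trans hq.1.symm) fun z hz => ?_
    rw [hq.2 hz, hp.2 (hp.1.symm ▸ hq.1 ▸ hz)]
  have h2 : Equivalent (κ₀.prod r) (r.prod κ₀) := by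
    have := of_mul_of_sub_of_mul_of_mem_relations κ₀ r
    rwa [of_mul_of, of_mul_of] at this
  have h3 : Equivalent (r.prod κ₀) (r.prod κ) := by
    refine Equivalent.prod (Equivalent.refl r) (Equivalent.symm ?_)
    exact κ.of_sub_of_restrict_mem_relations isSemialgebraic_unitIoo unitIoo_subset_unitIcc
      volume_unitIcc_diff_unitIoo
  have h4 : Equivalent (r.prod κ) (r.constMul (K 1 - K 0) halg) :=
    newtonLeibnizRel_subset_relations
      (prod_iccRep_sub_constMul_mem_newtonLeibnizRel r hk hki hK hKc hKd halg)
  exact ((h1.trans h2).trans h3).trans h4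

/-- **PRIMITIVE CRITERION, positive half**: if `K 1 ≠ K 0` then `KernelCancellation k`.
[folklore] -/
theorem kernelCancellation_of_primitive {k K : ℝ → ℝ}
    (hk : IsSemialgebraicFunOn ℚ unitIcc (fun x => k (x 0))) (hki : IntegrableOn k (Icc (0:ℝ) 1))
    (hK : IsSemialgebraicFunOn ℚ unitIcc (fun x => K (x 0))) (hKc : ContinuousOn K (Icc (0:ℝ) 1))
    (hKd : ∀ t ∈ Ioo (0:ℝ) 1, HasDerivAt K (k t) t) (halg : IsAlgebraic ℚ (K 1 - K 0))
    (hc : K 1 - K 0 ≠ 0) : KernelCancellation k := by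
  intro n m r r' q q' hq hq' hqq'
  have e1 := equivalent_constMul_of_isPinned_of_primitive hk hki hK hKc hKd halg hq
  have e2 := equivalent_constMul_of_isPinned_of_primitive hk hki hK hKc hKd halg hq'
  exact equivalent_of_equivalent_constMul halg hc ((e1.symm.trans hqq').trans e2)

/-- **PRIMITIVE CRITERION, negative half**: if `K 1 = K 0` then `KernelCancellation k` FAILS
(every pinned representation is a relation; witness `[π] ≁ −[π]`). [folklore] -/
theorem not_kernelCancellation_of_primitive {k K : ℝ → ℝ}
    (hk : IsSemialgebraicFunOn ℚ unitIcc (fun x => k (x 0))) (hki : IntegrableOn k (Icc (0:ℝ) 1))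
    (hK : IsSemialgebraicFunOn ℚ unitIcc (fun x => K (x 0))) (hKc : ContinuousOn K (Icc (0:ℝ) 1))
    (hKd : ∀ t ∈ Ioo (0:ℝ) 1, HasDerivAt K (k t) t) (hc : K 1 - K 0 = 0) :
    ¬ KernelCancellation k := by
  intro h
  have halg : IsAlgebraic ℚ (K 1 - K 0) := by
    rw [hc]
    exact isAlgebraic_zero
  have key : ∀ {n : ℕ} (r : IntegralRep n) (q : IntegralRep (1 + n)), IsPinned k r q →
      of q ∈ relations := by
    intro n r q hq
    have e := equivalent_constMul_of_isPinned_of_primitive hk hki hK hKc hKd halg hq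
    have hz : of (r.constMul (K 1 - K 0) halg) ∈ relations :=
      of_mem_relations_of_eqOn_zero _ fun x _ => by
        simp only [IntegralRep.integrand_constMul, hc, zero_mul, Pi.zero_apply]
    have := relations.add_mem e hz
    rwa [sub_add_cancel] at this
  set κ₀ : IntegralRep 1 :=
    (iccRep k hk hki).restrict unitIoo isSemialgebraic_unitIoo unitIoo_subset_unitIcc with hκ₀
  have hq := isPinned_prod κ₀ rfl (fun _ _ => rfl) piRep
  have hq' := isPinned_prod κ₀ rfl (fun _ _ => rfl) piRep.neg
  exact not_equivalent_piRep_neg (h piRep piRep.neg _ _ hq hq'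
    (relations.sub_mem (key _ _ hq) (key _ _ hq')))

/-- **THE PRIMITIVE CRITERION.** For a kernel `k` on `[0,1]` with a `ℚ`-semialgebraic primitive
`K ∈ C([0,1])`, `K' = k` on `(0,1)`: `KernelCancellation k ↔ K 1 ≠ K 0`. [folklore] -/
theorem kernelCancellation_iff_of_primitive {k K : ℝ → ℝ}
    (hk : IsSemialgebraicFunOn ℚ unitIcc (fun x => k (x 0))) (hki : IntegrableOn k (Icc (0:ℝ) 1))
    (hK : IsSemialgebraicFunOn ℚ unitIcc (fun x => K (x 0))) (hKc : ContinuousOn K (Icc (0:ℝ) 1))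
    (hKd : ∀ t ∈ Ioo (0:ℝ) 1, HasDerivAt K (k t) t) (halg : IsAlgebraic ℚ (K 1 - K 0)) :
    KernelCancellation k ↔ K 1 - K 0 ≠ 0 :=
  ⟨fun h hc => not_kernelCancellation_of_primitive hk hki hK hKc hKd hc h,
    kernelCancellation_of_primitive hk hki hK hKc hKd halg⟩

/-- The criterion's value is the integral: `K 1 − K 0 = ∫₀¹ k` (FTC), so the criterion is exactly
the value condition `∫₀¹ k ≠ 0` of §3, now DECIDED INSIDE the calculus. [folklore] -/
theorem integral_eq_of_primitive {k K : ℝ → ℝ} (hki : IntegrableOn k (Icc (0:ℝ) 1))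
    (hKc : ContinuousOn K (Icc (0:ℝ) 1)) (hKd : ∀ t ∈ Ioo (0:ℝ) 1, HasDerivAt K (k t) t) :
    ∫ t in Ioo (0:ℝ) 1, k t = K 1 - K 0 := by
  rw [← integral_Ioc_eq_integral_Ioo, ← intervalIntegral.integral_of_le zero_le_one]
  exact intervalIntegral.integral_eq_sub_of_hasDerivAt_of_le zero_le_one hKc hKd
    ((intervalIntegrable_iff_integrableOn_Icc_of_le zero_le_one).2 hki)

/-- `KernelCancellation` depends only on the kernel's values on `(0,1)`. [folklore] -/
theorem kernelCancellation_congr {k k' : ℝ → ℝ} (h : EqOn k k' (Ioo (0:ℝ) 1)) :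
    KernelCancellation k ↔ KernelCancellation k' := by
  have key : ∀ {k k' : ℝ → ℝ}, EqOn k k' (Ioo (0:ℝ) 1) → ∀ {n : ℕ} (r : IntegralRep n)
      (q : IntegralRep (1 + n)), IsPinned k r q → IsPinned k' r q := by
    intro k k' h n r q hq
    refine ⟨hq.1, fun z hz => ?_⟩
    rw [hq.2 hz]
    have hz' : z (Fin.castAdd n 0) ∈ Ioo (0:ℝ) 1 := by
      rw [hq.1] at hz
      exact hz.1
    simp only [pinFun, h hz']
  constructor
  · intro hc n m r r' q q' hq hq' hqq'
    exact hc r r' q q' (key h.symm r q hq) (key h.symm r' q' hq') hqq'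
  · intro hc n m r r' q q' hq hq' hqq'
    exact hc r r' q q' (key h r q hq) (key h r' q' hq') hqq'



end Summit.KontsevichZagierPeriods.KontsevichZagierPeriods.BetaCancellationNegative
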